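import Summits.BirchSwinnertonDyer.Rank1Residual.X11b.Three.HsiehDescent
import Summits.BirchSwinnertonDyer.Rank1Residual.X11b.Three.LambdaSupply
import HarnessLib

/-!
# X11b @ `p = 3`, S24 (λ-supply split), the hypothesis `hsup` DISCHARGED: every consumer of the
# S18 residual `HsiehFrameResidualAt₃ W` now READS the λ-free residual `HsiehDescentAt₃ W` GIVEN `(λ)`

HONEST FRAMING (cell `b2b-bsdres`, run/shared/lean/b2b/bsd-rank1-residual/, verbatim in every
file): the goal of the cell is to DELETE the COMBINATION-SHAPED residual classes of the
Birch–Swinnerton-Dyer formula for ALL analytic-rank `≤ 1` elliptic curves over `ℚ` — assembled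
STRICTLY from published theorems — so that the rank-`≤ 1` remainder becomes exactly the
CONSTRUCTION-SHAPED classes, which are TYPED, NOT attempted. This is not "finishing BSD". Team N8/O2
(X11b at `3`: `3 ‖ N`, `r_an = 1`, `E[3]` irreducible): research route; nothing booked; NO label
changes; O2 stays OPEN. WORDING OF RECORD (H45): S24 does NOT shrink, reduce or move the open
remainder `(t)`; the named residual `HsiehFrameResidualAt₃ W` READS `HsiehDescentAt₃ W` GIVEN
`(λ)`, and `(λ)` is now a THEOREM (`Three.lambdaSupplyAt₃`). `(t)` = `HsiehDescentAt₃ W` is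
UNCHANGED, UNPRINTED as a statement at `3 ∣ N`, TYPED (`@[conjecture] def`), NOT attempted.
THEOREMS ONLY; no definition, no fact, no `sorry`.

PROVENANCE: sub-target S24 'λ-SUPPLY SPLIT' (OWNERS R7-59 / R7-66 / R8-4 / R8-16), seat
`b2b-bsdres-x11b3-p7` (gen. 4): S24-a = `LambdaSupply.lean` (`Three.lambdaSupplyAt₃`, with seat
p2's (A)/(C)/(B-q)), S24-b and S24-c = `HsiehDescent.lean` (p261034). This file = memo
`HOME/b2b-bsdres-x11b3-p7/s24/S24-FEASIBILITY.md` §5 (6): the `hsup`-free corollaries. The file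
`HsiehDescent.lean` is untouched (its `hsup`-parametrised theorems stay, for readers who want the
λ-supply as an explicit input).

## Contents (each ONE line: the `hsup` binder := `lambdaSupplyAt₃`)

* `hsiehFrameResidualAt₃_of_hsiehDescentAt₃` and the EQUIVALENCE
  `hsiehFrameResidualAt₃_iff_hsiehDescentAt₃ : HsiehFrameResidualAt₃ W ↔ HsiehDescentAt₃ W` — the
  S18 residual and its λ-free part are now INTERCHANGEABLE in the kernel.
* `bdpExistsAt₃_of_hsieh2014_of_hsiehDescentAt₃` (H1 from print + descent),
  `bsdp_of_halves₃_onA1_of_hsieh2014_of_hsiehDescentAt₃` (`H2 ∧ H3 ⟹ BSD(E,3)` on A1),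
  `missingInputAt_of_halves₃_onA1_of_hsieh2014_of_hsiehDescentAt₃` (per-pair bookkeeping) —
  S18(b)'s end theorems with `hres : HsiehFrameResidualAt₃ W` replaced by `hdesc : HsiehDescentAt₃ W`
  ALONE. CONDITIONAL on every listed fact binder exactly as before; nothing booked.

## Gloss of record on `(t) = HsiehDescentAt₃ W` (lit1 LIT-TABLE L61 (P1)–(P4), L63; READINGS with
## locators, docstring matter only — what `(t)` COSTS at author level, not that it moved)

(t1), every `K`: Hsieh's construction is `(𝒪_L·𝓦)`-integral IN PRINT (proof of Thm. 6.1
[arXiv:1112.1580 p. 25 l. 27, l. 38]: forms over `𝒪 = ℤ₃[λ̂]` (Prop. 3.15 with `A(λ) = B(λ) = ∅`,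
`L_π = ℚ₃` [p. 16 ll. 56–60, p. 15 l. 21, p. 10 l. 14]), CM points and `t`-expansions over
`𝓦 = W(𝔽̄₃)[λ̂]` [p. 21 l. 30, p. 25 ll. 7–13]), the ONE construction-level sentence being
`𝒪_L ⊂ ℚ₃(λ̂-values)` ((W₃), L63); then `X := [g]⁻¹ Tw_{λ̂⁻¹}(𝒫²) ∈ R₀[λ̂(γ)]⟦T⟧` is λ-INDEPENDENT by
the printed twist-compatibility (Lemma 5.4 (1), Prop. 5.5 uniqueness [p. 23 ll. 22–27, 40–46]) — so
σ-naturality (n2) is ONE sufficient route, needed at most for `k(K,3) ≥ 1` and for `k = 0` the choice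
of `λ` is immaterial (P3) — and descends to `R₀⟦T⟧` by the twist-intersection lemma over `ℚ̂₃^{ur}`
(multr1-p1 DESCENT-NOTE Step B, `p` odd; trivial when `k(K,3) = 0` with the `R₀`-valued `λ`).
(t2) `Ω_p ∈ R₀ˣ` IN PRINT (P1): Hida–Tilouine 1993 p. 192 "the `p`-adic period is found in `(𝒪^×)^Σ`
[see (4.4 a, b)]", `𝒪 = 𝒪(ℚ̂_p^{ur})` [p. 190] — Hsieh's own reference for `(Ω_∞, Ω_p)` [p. 23
l. 64]; de Shalit 1987 II.4.11 Rem. (iii) at `F = ℚ`. (t3) the constant `C` is λ-independent and lies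
in `±2^ℤ √|d_K| · ∏_{v ∣ N₀} ε(½, π_v, ψ_v) ⊂ R₀ˣ` (Prop. 5.2 + eq. (E:constantC) [p. 22 ll. 43–49,
p. 17 ll. 1–5] + Lemma 5.4 (2), the `λ(ℭ)` cancelling in (W3) of `IsHsiehLFunction`) (P2). (P4) the
`K`-level index `κ(I_𝔭) = ⊤ ⟺ k(K,3) = 0` checks at the page (CFT: the inertia at `𝔭` of
`Gal(K[3^∞]/K)` is the image of `ℤ₃ˣ`). UNPRINTED as a statement at `3 ∣ N`; TYPED, not attempted.

## References

* [Hsieh2014] M.-L. Hsieh, *Special values of anticyclotomic Rankin–Selberg L-functions*,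
  Doc. Math. 19 (2014), Thm. 1 (arXiv:1112.1580 pp. 3–4), Prop. 3.15, Lemma 5.4, Prop. 5.5, Thm. 6.1.
* [HidaTilouine1993] H. Hida, J. Tilouine, *Anti-cyclotomic Katz `p`-adic `L`-functions and
  congruence modules*, Ann. Sci. ÉNS 26 (1993), pp. 190–192.
* Cell files: `cells/x11b3/OWNERS.md` R7-59, R8-16; `LIT-TABLE.md` L58–L63.
-/

noncomputable section

open scoped Classical

open WeierstrassCurve NumberField IsDedekindDomain Field
  Literature.NumberTheory.EllipticCurves Literature.NumberTheory.EllipticCurves.GreenbergSelmer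
  Literature.NumberTheory.EllipticCurves.ModularForms Literature.NumberTheory.EllipticCurves.Rank1Residual
  Literature.NumberTheory.EllipticCurves.Rank1Residual.Typed Literature.NumberTheory.EllipticCurves.Wuthrich2014
  Literature.NumberTheory.GaloisRepresentations Literature.NumberTheory.GaloisCohomology
  Literature.NumberTheory.Automorphic
  Summit.BirchSwinnertonDyer.Rank1Residual.X11b.AcSelmer Summit.BirchSwinnertonDyer.Rank1Residual.X11b.LocBridge

namespace Summit.BirchSwinnertonDyer.Rank1Residual.X11b.Three

variable (W : WeierstrassCurve ℚ) [W.IsElliptic] [W.IsGloballyMinimal]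

omit [W.IsElliptic] [W.IsGloballyMinimal] in
/-- **`HsiehDescentAt₃ W ⟹ HsiehFrameResidualAt₃ W`, UNCONDITIONAL** (the λ-supply `hsup` of
`hsiehFrameResidualAt₃_of_descent` := the theorem `Three.lambdaSupplyAt₃`). H45: the S18 residual
READS its λ-free part GIVEN `(λ)`; `(t)` unchanged. [cite: Hsieh2014, Thm. 1 (arXiv:1112.1580 pp. 3–4)] -/
theorem hsiehFrameResidualAt₃_of_hsiehDescentAt₃ (hdesc : HsiehDescentAt₃ W) :
    HsiehFrameResidualAt₃ W :=
  hsiehFrameResidualAt₃_of_descent W lambdaSupplyAt₃ hdesc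

omit [W.IsElliptic] [W.IsGloballyMinimal] in
/-- **The S18 residual and its λ-free part are EQUIVALENT in the kernel**:
`HsiehFrameResidualAt₃ W ↔ HsiehDescentAt₃ W` (⇒ lossless split, ⇐ λ-supply). Both sides remain
`@[conjecture]` nodes: UNPRINTED as statements at `3 ∣ N`, TYPED, not attempted; nothing booked.
[cite: Hsieh2014, Thm. 1 (arXiv:1112.1580 pp. 3–4)] -/
theorem hsiehFrameResidualAt₃_iff_hsiehDescentAt₃ : HsiehFrameResidualAt₃ W ↔ HsiehDescentAt₃ W :=
  ⟨hsiehDescentAt₃_of_hsiehFrameResidualAt₃ W, hsiehFrameResidualAt₃_of_hsiehDescentAt₃ W⟩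

/-- **H1 from print + descent**: `BDPExistsAt₃ W` from the named fact `hH` (Hsieh 2014 Thm. 1,
published) and the named residual `hdesc : HsiehDescentAt₃ W` (NOT in print at `3 ∣ N`) ALONE — the
λ-supply is a theorem. CONDITIONAL on `hH` and `hdesc`; nothing booked; O2 OPEN.
[cite: Hsieh2014, Thm. 1 (arXiv:1112.1580 pp. 3–4)] -/
theorem bdpExistsAt₃_of_hsieh2014_of_hsiehDescentAt₃
    (hH : hsieh2014_exists_anticyclotomicPAdicLFunction) (hdesc : HsiehDescentAt₃ W) :
    BDPExistsAt₃ W :=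
  bdpExistsAt₃_of_hsieh2014_of_descent W hH lambdaSupplyAt₃ hdesc

/-- **`H2 ∧ H3 ⟹ BSD(E,3)` on A1 given Hsieh 2014 Thm. 1 and the descent residual**:
`bsdp_of_halves₃_onA1_of_hsieh2014_of_descent` with `hsup` := `Three.lambdaSupplyAt₃`. CONDITIONAL on
every listed fact binder, on the named residual `hdesc` and the two typed halves; per pair; nothing
booked; no label change; O2 OPEN. [cite: Hsieh2014, Thm. 1 (arXiv:1112.1580 pp. 3–4)]
[cite: Castella2018, Thm. 2.3 (p. 5), Thm. 3.2 (p. 9), §5 (p. 12)] [cite: JetchevSkinnerWan2017, Thm. 3.3.1 (p. 11)]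
[cite: Miller2011LMS, Def. 1.1] -/
theorem bsdp_of_halves₃_onA1_of_hsieh2014_of_hsiehDescentAt₃
    (hGZ : ∀ (N : ℕ) [NeZero N] (W : WeierstrassCurve ℚ) (K : Type) [Field K] [NumberField K],
      gross_zagier N W K)
    (hKo : ∀ (N : ℕ) [NeZero N] (W : WeierstrassCurve ℚ) (K : Type) [Field K] [NumberField K],
      kolyvagin N W K)
    (hB : ∀ (N : ℕ) [NeZero N] (W : WeierstrassCurve ℚ) (K : Type) [Field K] [NumberField K],
      Kolyvagin1990_padicValNat_card_sha_le N W K)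
    (hSk : Skinner2016.thmC_padicValRat_bsd_rank_zero) (hWu : sha_dvd_analyticSha)
    (hGZK : rank_eq_analyticRank_of_analyticRank_le_one) (hmod : hasEntireLFunction_rat)
    (hnf : exists_isNewformOf) (hHL : HoffsteinLuo1997_exists_twist_L_one_ne_zero)
    (hMaz : mazur_not_dvd_maninConstant_of_odd)
    (hPT : ∀ (K : Type) [Field K] [NumberField K], poitouTate_sum_localTatePairing_eq_zero K)
    (hEP : ∀ (K : Type) [Field K] [NumberField K] (v : HeightOneSpectrum (𝓞 K)),
      localEulerPoincareCharacteristic (v.adicCompletion K))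
    (hPTs : ∀ (K : Type) [Field K] [NumberField K], poitouTate_selmerStructure_duality K)
    (hPT2 : ∀ (K : Type) [Field K] [NumberField K], poitouTate_sha_tateDual K)
    (hcd : fieldCdLE_two_of_numberField) (hH : hsieh2014_exists_anticyclotomicPAdicLFunction)
    (hX : ClassX11b W 3) (hram : Ram W 3) (htam : ¬ 3 ∣ W.tamagawaProduct)
    (hdesc : HsiehDescentAt₃ W) (h2 : BDPValueAt₃ W) (h3 : IMCDivAt₃ W) : BSDp W 3 :=
  bsdp_of_halves₃_onA1_of_hsieh2014_of_descent W hGZ hKo hB hSk hWu hGZK hmod hnf hHL hMaz hPT hEP hPTs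
    hPT2 hcd hH lambdaSupplyAt₃ hX hram htam hdesc h2 h3

/-- **Per-pair bookkeeping**: on A1, under Hsieh 2014 Thm. 1, the descent residual, H2, H3 and the
listed facts, the CLASS's typed missing input `X11Three.MissingInputAt W` holds at the pair `(E, 3)`
(`missingInputAt_of_halves₃_onA1_of_hsieh2014_of_descent` with `hsup` := `Three.lambdaSupplyAt₃`). The
`Prop` about the CLASS is NOT made available; nothing booked.
[cite: Miller2011LMS, §1 and Def. 1.1 (arXiv:1010.2431 p. 3)] -/
theorem missingInputAt_of_halves₃_onA1_of_hsieh2014_of_hsiehDescentAt₃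
    (hGZ : ∀ (N : ℕ) [NeZero N] (W : WeierstrassCurve ℚ) (K : Type) [Field K] [NumberField K],
      gross_zagier N W K)
    (hKo : ∀ (N : ℕ) [NeZero N] (W : WeierstrassCurve ℚ) (K : Type) [Field K] [NumberField K],
      kolyvagin N W K)
    (hB : ∀ (N : ℕ) [NeZero N] (W : WeierstrassCurve ℚ) (K : Type) [Field K] [NumberField K],
      Kolyvagin1990_padicValNat_card_sha_le N W K)
    (hSk : Skinner2016.thmC_padicValRat_bsd_rank_zero) (hWu : sha_dvd_analyticSha)
    (hGZK : rank_eq_analyticRank_of_analyticRank_le_one) (hmod : hasEntireLFunction_rat)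
    (hnf : exists_isNewformOf) (hHL : HoffsteinLuo1997_exists_twist_L_one_ne_zero)
    (hMaz : mazur_not_dvd_maninConstant_of_odd)
    (hPT : ∀ (K : Type) [Field K] [NumberField K], poitouTate_sum_localTatePairing_eq_zero K)
    (hEP : ∀ (K : Type) [Field K] [NumberField K] (v : HeightOneSpectrum (𝓞 K)),
      localEulerPoincareCharacteristic (v.adicCompletion K))
    (hPTs : ∀ (K : Type) [Field K] [NumberField K], poitouTate_selmerStructure_duality K)
    (hPT2 : ∀ (K : Type) [Field K] [NumberField K], poitouTate_sha_tateDual K)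
    (hcd : fieldCdLE_two_of_numberField) (hH : hsieh2014_exists_anticyclotomicPAdicLFunction)
    (hX : ClassX11b W 3) (hram : Ram W 3) (htam : ¬ 3 ∣ W.tamagawaProduct)
    (hdesc : HsiehDescentAt₃ W) (h2 : BDPValueAt₃ W) (h3 : IMCDivAt₃ W) :
    X11Three.MissingInputAt W :=
  missingInputAt_of_halves₃_onA1_of_hsieh2014_of_descent W hGZ hKo hB hSk hWu hGZK hmod hnf hHL hMaz hPT
    hEP hPTs hPT2 hcd hH lambdaSupplyAt₃ hX hram htam hdesc h2 h3

end Summit.BirchSwinnertonDyer.Rank1Residual.X11b.Three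

end
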